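import Literature.AlgebraicGeometry.Frobenioids.FrobeniusTypeIsotropic
import Literature.AlgebraicGeometry.Frobenioids.PullbackLinear
import HarnessLib

/-!
# Frobenioids I, Theorem 4.2, proof, first paragraph: group-like objects ("WLOG non-group-like")

Mochizuki, *The geometry of Frobenioids I: the general theory*, Kyushu J. Math. **62** (2008)
293–400, §4, Theorem 4.2, kurims text p. 77 (statement), p. 78 ll. 28–35 (proof)
[cite: MochizukiFrdI2008, Thm. 4.2 (i) p.78]:

  "First, we observe that by Proposition 1.10, (vi), every group-like object is Frobenius-trivial,
  hence, in particular, Div-Frobenius-trivial; moreover, [by the definition of a 'group-like object']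
  every endomorphism of a group-like object is a Div-identity endomorphism, and every pre-step to
  or from a group-like object is an isomorphism [cf. Propositions 1.4, (i), (iii); 1.8, (iii)].
  Thus, since `Ψ` preserves non-group-like objects [cf. Theorem 3.4, (ii)] and pull-back morphisms
  [cf. Theorem 3.4, (iii)], we may assume for the remainder of the proof of Theorem 4.2, without loss
  of generality, that the objects under consideration are non-group-like."

PROVED here (sub-node `FrdI:Thm4.2(i)/T42-L01` `GroupLikeWLOG` of `plan/L1/SUBDAG-FrdI-Thm42-Thm49.md`,
holder abc-iut-L1-t14; this piece abc-iut-L1-t2), for a Frobenioid `C → F_Φ` of isotropic type (the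
setting of Thm. 4.2):
* a group-like object is Frobenius-trivial (Prop. 1.10 (vi), seat abc-iut-L1-t1's
  `isFrobeniusTrivial_of_isGroupLikeObj_of_isOfIsotropicType`), hence universally Div-Frobenius-trivial
  (Remark 1.11.1, `IsFrobeniusTrivial.isUniversallyDivFrobeniusTrivial`) and Div-Frobenius-trivial
  (`isDivFrobeniusTrivial_of_isGroupLikeObj`, `isUniversallyDivFrobeniusTrivial_of_isGroupLikeObj`);
* every endomorphism of a group-like object is a Div-identity endomorphism
  (`isDivIdentity_of_isGroupLikeObj` — `Φ(A) = 0`);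
* every pre-step to or from a group-like object is an isomorphism (`isIso_of_isPreStep_from_groupLike`,
  `isIso_of_isPreStep_to_groupLike`), so a step has non-group-like domain and codomain
  (`not_isGroupLikeObj_of_isStep`);
* the "WLOG": for a functor `Ψ` carrying group-like objects to group-like objects [Thm. 3.4 (ii); for
  `D₁` of FSM-type this is seat abc-iut-L1-t13's `isGroupLikeObj_map_of_isOfFSMType`], the four
  preservation clauses of Thm. 4.2 (i) — steps which are primary pre-steps, Div-identity
  endomorphisms, Div-Frobenius-trivial objects, universally Div-Frobenius-trivial objects — hold at
  group-like objects outright (`…_map_of_isGroupLikeObj`), so they hold everywhere as soon as they hold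
  at non-group-like objects (`thm42i_of_nonGroupLike`).
All inputs are the printed ones BY NAME; hypotheses on `Ψ` are stated as in seat abc-iut-L1-t14's
`PrimaryStepsTransport.lean`.  No new definitions.
-/

namespace Literature.AlgebraicGeometry.Frobenioids

open CategoryTheory Opposite

namespace PreFrobenioid

universe w v v' u u' w₂ v₂ v₂' u₂ u₂'

variable {D : Type u} [Category.{v} D] {Φ : Dᵒᵖ ⥤ CommMonCat.{w}}
  {C : Type u'} [Category.{v'} C] {F : C ⥤ ElemFrobenioid Φ}

/-! ### Group-like objects of one Frobenioid -/

/-- "Every endomorphism of a group-like object is a Div-identity endomorphism" (`Φ(A) = 0`, so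
`Base(α)^*` is the identity of `Φ(A)`). [cite: MochizukiFrdI2008, Thm. 4.2 (i) p.78] -/
theorem isDivIdentity_of_isGroupLikeObj {A : C} (hA : IsGroupLikeObj F A) (α : A ⟶ A) :
    IsDivIdentity F α := by
  unfold IsDivIdentity
  ext x
  exact (hA _).trans (hA _).symm

/-- An object admitting a base-isomorphism to a group-like object is group-like (Prop. 1.8 (iii):
"if `A`, `B` are base-isomorphic objects, then `A` is group-like if and only if `B` is").
[cite: MochizukiFrdI2008, Prop. 1.8 (iii) p.30] -/
theorem isGroupLikeObj_of_isPreStep_to {B A : C} {φ : B ⟶ A} (hφ : IsPreStep F φ)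
    (hA : IsGroupLikeObj F A) : IsGroupLikeObj F B :=
  isGroupLikeObj_of_isBaseIso φ hφ.2 hA

/-- "Every pre-step … from a group-like object is an isomorphism" — in a Frobenioid of isotropic
type (the pre-step is isometric, Def. 1.2 (iv); cf. Prop. 1.4 (i), (iii)).
[cite: MochizukiFrdI2008, Thm. 4.2 (i) p.78] -/
theorem isIso_of_isPreStep_from_groupLike (histr : IsOfIsotropicType F) {A B : C}
    (hA : IsGroupLikeObj F A) {φ : A ⟶ B} (hφ : IsPreStep F φ) : IsIso φ :=
  histr A φ (hA _) hφ

/-- "Every pre-step to … a group-like object is an isomorphism" — in a Frobenioid of isotropic type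
(its domain is again group-like, Prop. 1.8 (iii)). [cite: MochizukiFrdI2008, Thm. 4.2 (i) p.78] -/
theorem isIso_of_isPreStep_to_groupLike (histr : IsOfIsotropicType F) {B A : C}
    (hA : IsGroupLikeObj F A) {φ : B ⟶ A} (hφ : IsPreStep F φ) : IsIso φ :=
  isIso_of_isPreStep_from_groupLike histr (isGroupLikeObj_of_isPreStep_to hφ hA) hφ

/-- A step (a pre-step which is not an isomorphism) of a Frobenioid of isotropic type has
non-group-like domain and codomain. [cite: MochizukiFrdI2008, Thm. 4.2 (i) p.78] -/
theorem not_isGroupLikeObj_of_isStep (histr : IsOfIsotropicType F) {X Y : C} {φ : X ⟶ Y}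
    (hφ : IsStep F φ) : ¬ IsGroupLikeObj F X ∧ ¬ IsGroupLikeObj F Y :=
  ⟨fun hX => hφ.2 (isIso_of_isPreStep_from_groupLike histr hX hφ.1),
    fun hY => hφ.2 (isIso_of_isPreStep_to_groupLike histr hY hφ.1)⟩

/-- "By Proposition 1.10, (vi), every group-like object is Frobenius-trivial, hence, in particular"
universally Div-Frobenius-trivial (Remark 1.11.1) — in a Frobenioid of isotropic type.
[cite: MochizukiFrdI2008, Thm. 4.2 (i) p.78] -/
theorem isUniversallyDivFrobeniusTrivial_of_isGroupLikeObj (hF : IsFrobenioid F)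
    (histr : IsOfIsotropicType F) {A : C} (hA : IsGroupLikeObj F A) :
    IsUniversallyDivFrobeniusTrivial F A :=
  (isFrobeniusTrivial_of_isGroupLikeObj_of_isOfIsotropicType hF histr hA).isUniversallyDivFrobeniusTrivial hF

/-- "… every group-like object is Frobenius-trivial, hence, in particular, Div-Frobenius-trivial" — in
a Frobenioid of isotropic type. [cite: MochizukiFrdI2008, Thm. 4.2 (i) p.78] -/
theorem isDivFrobeniusTrivial_of_isGroupLikeObj (hF : IsFrobenioid F) (histr : IsOfIsotropicType F)
    {A : C} (hA : IsGroupLikeObj F A) : IsDivFrobeniusTrivial F A :=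
  (isUniversallyDivFrobeniusTrivial_of_isGroupLikeObj hF histr hA).isDivFrobeniusTrivial

/-! ### The four clauses of Thm. 4.2 (i) at group-like objects, for a functor preserving them -/

variable {D₂ : Type u₂} [Category.{v₂} D₂] {Φ₂ : D₂ᵒᵖ ⥤ CommMonCat.{w₂}}
  {C₂ : Type u₂'} [Category.{v₂'} C₂] {F₂ : C₂ ⥤ ElemFrobenioid Φ₂} (Ψ : C ⥤ C₂)

/-- `Ψ` maps every endomorphism of a group-like object to a Div-identity endomorphism, provided `Ψ`
carries group-like objects to group-like objects [Thm. 3.4 (ii)].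
[cite: MochizukiFrdI2008, Thm. 4.2 (i) p.78] -/
theorem isDivIdentity_map_of_isGroupLikeObj
    (hgl : ∀ ⦃A : C⦄, IsGroupLikeObj F A → IsGroupLikeObj F₂ (Ψ.obj A)) {A : C}
    (hA : IsGroupLikeObj F A) (α : A ⟶ A) : IsDivIdentity F₂ (Ψ.map α) :=
  isDivIdentity_of_isGroupLikeObj (hgl hA) (Ψ.map α)

/-- `Ψ` maps a group-like object to a universally Div-Frobenius-trivial object (of a Frobenioid of
isotropic type), provided `Ψ` carries group-like objects to group-like objects.
[cite: MochizukiFrdI2008, Thm. 4.2 (i) p.78] -/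
theorem isUniversallyDivFrobeniusTrivial_map_of_isGroupLikeObj (hF₂ : IsFrobenioid F₂)
    (histr₂ : IsOfIsotropicType F₂)
    (hgl : ∀ ⦃A : C⦄, IsGroupLikeObj F A → IsGroupLikeObj F₂ (Ψ.obj A)) {A : C}
    (hA : IsGroupLikeObj F A) : IsUniversallyDivFrobeniusTrivial F₂ (Ψ.obj A) :=
  isUniversallyDivFrobeniusTrivial_of_isGroupLikeObj hF₂ histr₂ (hgl hA)

/-- `Ψ` maps a group-like object to a Div-Frobenius-trivial object (of a Frobenioid of isotropic
type), provided `Ψ` carries group-like objects to group-like objects.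
[cite: MochizukiFrdI2008, Thm. 4.2 (i) p.78] -/
theorem isDivFrobeniusTrivial_map_of_isGroupLikeObj (hF₂ : IsFrobenioid F₂)
    (histr₂ : IsOfIsotropicType F₂)
    (hgl : ∀ ⦃A : C⦄, IsGroupLikeObj F A → IsGroupLikeObj F₂ (Ψ.obj A)) {A : C}
    (hA : IsGroupLikeObj F A) : IsDivFrobeniusTrivial F₂ (Ψ.obj A) :=
  isDivFrobeniusTrivial_of_isGroupLikeObj hF₂ histr₂ (hgl hA)

/-- **Thm. 4.2 (i), "we may assume … without loss of generality, that the objects under consideration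
are non-group-like"** (FrdI p. 78 ll. 28–35).  Let `C → F_Φ`, `C₂ → F_{Φ₂}` be Frobenioids of
isotropic type and `Ψ : C → C₂` a functor carrying group-like objects to group-like objects
[Thm. 3.4 (ii)].  If the four clauses of Thm. 4.2 (i) hold at NON-group-like objects — `Ψ` maps
primary steps between non-group-like objects to primary steps, Div-identity endomorphisms of
non-group-like objects to Div-identity endomorphisms, and non-group-like (universally)
Div-Frobenius-trivial objects to (universally) Div-Frobenius-trivial objects — then they hold at all
objects. [cite: MochizukiFrdI2008, Thm. 4.2 (i) p.78] -/
theorem thm42i_of_nonGroupLike (hF₂ : IsFrobenioid F₂) (histr : IsOfIsotropicType F)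
    (histr₂ : IsOfIsotropicType F₂)
    (hgl : ∀ ⦃A : C⦄, IsGroupLikeObj F A → IsGroupLikeObj F₂ (Ψ.obj A))
    (hstep : ∀ ⦃X Y : C⦄ (φ : X ⟶ Y), ¬ IsGroupLikeObj F X → ¬ IsGroupLikeObj F Y →
      IsStep F φ → IsPrimaryPreStep F φ → IsStep F₂ (Ψ.map φ) ∧ IsPrimaryPreStep F₂ (Ψ.map φ))
    (hdivId : ∀ ⦃A : C⦄ (α : A ⟶ A), ¬ IsGroupLikeObj F A → IsDivIdentity F α →
      IsDivIdentity F₂ (Ψ.map α))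
    (hdft : ∀ ⦃A : C⦄, ¬ IsGroupLikeObj F A → IsDivFrobeniusTrivial F A →
      IsDivFrobeniusTrivial F₂ (Ψ.obj A))
    (hudft : ∀ ⦃A : C⦄, ¬ IsGroupLikeObj F A → IsUniversallyDivFrobeniusTrivial F A →
      IsUniversallyDivFrobeniusTrivial F₂ (Ψ.obj A)) :
    (∀ ⦃X Y : C⦄ (φ : X ⟶ Y), IsStep F φ → IsPrimaryPreStep F φ →
        IsStep F₂ (Ψ.map φ) ∧ IsPrimaryPreStep F₂ (Ψ.map φ)) ∧
      (∀ ⦃A : C⦄ (α : A ⟶ A), IsDivIdentity F α → IsDivIdentity F₂ (Ψ.map α)) ∧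
      (∀ ⦃A : C⦄, IsDivFrobeniusTrivial F A → IsDivFrobeniusTrivial F₂ (Ψ.obj A)) ∧
      (∀ ⦃A : C⦄, IsUniversallyDivFrobeniusTrivial F A →
        IsUniversallyDivFrobeniusTrivial F₂ (Ψ.obj A)) := by
  refine ⟨fun X Y φ hφ hφp => ?_, fun A α hα => ?_, fun A hA => ?_, fun A hA => ?_⟩
  · obtain ⟨hX, hY⟩ := not_isGroupLikeObj_of_isStep histr hφ
    exact hstep φ hX hY hφ hφp
  · by_cases hg : IsGroupLikeObj F A
    · exact isDivIdentity_map_of_isGroupLikeObj Ψ hgl hg α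
    · exact hdivId α hg hα
  · by_cases hg : IsGroupLikeObj F A
    · exact isDivFrobeniusTrivial_map_of_isGroupLikeObj Ψ hF₂ histr₂ hgl hg
    · exact hdft hg hA
  · by_cases hg : IsGroupLikeObj F A
    · exact isUniversallyDivFrobeniusTrivial_map_of_isGroupLikeObj Ψ hF₂ histr₂ hgl hg
    · exact hudft hg hA

end PreFrobenioid

end Literature.AlgebraicGeometry.Frobenioids
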